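import Literature.Probability.RandomGraphs.ErdosRenyiMass
import Mathlib.Data.Sym.Sym2.Order
import HarnessLib

/-!
# Cylinder events of `G(n, p)`: prescribed present and absent edges

For disjoint sets `T`, `D` of pairs of distinct vertices,
`Pr[T ⊆ E(G(n,p)) and E(G(n,p)) ∩ D = ∅] = q^{|T|} (1 - q)^{|D|}`, `q = edgeProb p` — the edge
indicators of the binomial random graph are independent (Rödl–Ruciński 1995, p. 919: "all
`C(n,2)` decisions are mutually independent"). This is the probabilistic input of Nenadov–Steger's
proof of the 1-statement (CPC 2016, p. 3: "Note that the two events in the above probability are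
independent and the probability can thus be bounded by `p^{|⋃ T|} (1-p)^{δn²}`"), formalised for
`Literature.Probability.RandomGraphs.RodlRucinski1995_oneStatement`. Also: the complement rule
for `PMF.toOuterMeasure` and the real-number form of `q^a (1-q)^b`.

All statements are theorems; no named facts.

## References

* V. Rödl, A. Ruciński, JAMS 8 (1995), p. 919 (the binomial model). [RodlRucinski1995]
* R. Nenadov, A. Steger, CPC 25 (2016), proof of Thm. 1 (1-statement), p. 3. [NenadovSteger2014]
-/

noncomputable section

namespace Literature.Probability.RandomGraphs

open PlantedClique Finset

/-! ### The bit of a pair -/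

/-- The coordinate of the bit of `G(n, p)` deciding the pair `x`: `(min x, max x)` in the
`n × n` bit vector. [folklore] -/
def pairCoord {n : ℕ} (x : Sym2 (Fin n)) : Fin (n * n) := finProdFinEquiv (x.inf, x.sup)

/-- `pairCoord` is injective (a pair is determined by its minimum and maximum). [folklore] -/
theorem pairCoord_injective (n : ℕ) : Function.Injective (pairCoord (n := n)) := by
  intro x y h
  have h' := finProdFinEquiv.injective h
  rw [Prod.mk.injEq] at h'
  exact Sym2.inf_eq_inf_and_sup_eq_sup.1 h'

/-- A pair of distinct vertices is `{min, max}` with `min < max`. [folklore] -/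
theorem inf_lt_sup_of_not_isDiag {n : ℕ} {x : Sym2 (Fin n)} (hx : ¬ x.IsDiag) : x.inf < x.sup := by
  induction x using Sym2.ind with
  | _ a b =>
    rw [Sym2.mk_isDiag_iff] at hx
    rw [Sym2.inf_mk, Sym2.sup_mk]
    rcases lt_or_gt_of_ne hx with h | h
    · rwa [min_eq_left h.le, max_eq_right h.le]
    · rwa [min_eq_right h.le, max_eq_left h.le]

/-- `x = s(min x, max x)`. [folklore] -/
theorem mk_inf_sup {n : ℕ} (x : Sym2 (Fin n)) : s(x.inf, x.sup) = x := by
  induction x using Sym2.ind with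
  | _ a b =>
    rw [Sym2.inf_mk, Sym2.sup_mk]
    rcases le_total a b with h | h
    · rw [min_eq_left h, max_eq_right h]
    · rw [min_eq_right h, max_eq_left h, Sym2.eq_swap]

/-- **Which bit decides a pair**: for a pair `x` of distinct vertices, `x` is an edge of the
sampled graph iff the bit at `pairCoord x` is set. [folklore] -/
theorem mem_edgeSet_graphOfBits_iff {n : ℕ} (s : Fin (n * n) → Bool) {x : Sym2 (Fin n)}
    (hx : ¬ x.IsDiag) : x ∈ (graphOfBits n s).edgeSet ↔ s (pairCoord x) = true := by
  conv_lhs => rw [← mk_inf_sup x]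
  rw [SimpleGraph.mem_edgeSet, graphOfBits_adj_of_lt s (inf_lt_sup_of_not_isDiag hx)]
  rfl

/-! ### Cylinder events -/

/-- **Prescribed present and absent edges** (independence of the edge indicators of `G(n, p)`):
for disjoint finite sets `T, D` of pairs of distinct vertices,
`Pr[ T ⊆ E(G) ∧ E(G) ∩ D = ∅ ] = q^{|T|} (1 - q)^{|D|}`, `q = edgeProb p`.
[cite: RodlRucinski1995, §1 (p. 919, the binomial model: "all decisions are mutually independent")] -/
theorem erdosRenyi_toOuterMeasure_cylinder {n : ℕ} (p : ℝ) (T D : Finset (Sym2 (Fin n)))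
    (hTD : Disjoint T D) (hT : ∀ x ∈ T, ¬ x.IsDiag) (hD : ∀ x ∈ D, ¬ x.IsDiag) :
    (erdosRenyi n p).toOuterMeasure
        {G | (∀ x ∈ T, x ∈ G.edgeSet) ∧ ∀ x ∈ D, x ∉ G.edgeSet} =
      edgeProb p ^ #T * (1 - edgeProb p) ^ #D := by
  classical
  rw [erdosRenyi_toOuterMeasure_apply]
  set pc : Sym2 (Fin n) ↪ Fin (n * n) := ⟨pairCoord, pairCoord_injective n⟩ with hpc
  set U : Finset (Fin (n * n)) := (T ∪ D).map pc with hU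
  set σ : Fin (n * n) → Bool := fun c => decide (c ∈ T.map pc) with hσ
  have hσT : ∀ x ∈ T, σ (pairCoord x) = true := by
    intro x hx
    rw [hσ, decide_eq_true_iff]
    exact mem_map.2 ⟨x, hx, rfl⟩
  have hσD : ∀ x ∈ D, σ (pairCoord x) = false := by
    intro x hx
    rw [hσ, decide_eq_false_iff_not]
    intro hmem
    rw [mem_map] at hmem
    obtain ⟨y, hy, hyx⟩ := hmem
    have : y = x := pairCoord_injective n hyx
    subst this
    exact disjoint_left.1 hTD hy hx
  have hset : {s : Fin (n * n) → Bool | graphOfBits n s ∈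
      {G : SimpleGraph (Fin n) | (∀ x ∈ T, x ∈ G.edgeSet) ∧ ∀ x ∈ D, x ∉ G.edgeSet}} =
      {s | ∀ c ∈ U, s c = σ c} := by
    ext s
    simp only [Set.mem_setOf_eq]
    constructor
    · rintro ⟨h1, h2⟩ c hc
      rw [hU, mem_map] at hc
      obtain ⟨x, hx, rfl⟩ := hc
      rcases mem_union.1 hx with hxT | hxD
      · rw [show pc x = pairCoord x from rfl, hσT x hxT]
        exact (mem_edgeSet_graphOfBits_iff s (hT x hxT)).1 (h1 x hxT)
      · rw [show pc x = pairCoord x from rfl, hσD x hxD]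
        have := h2 x hxD
        rw [mem_edgeSet_graphOfBits_iff s (hD x hxD)] at this
        simpa using this
    · intro h
      refine ⟨fun x hx => ?_, fun x hx => ?_⟩
      · rw [mem_edgeSet_graphOfBits_iff s (hT x hx), ← hσT x hx]
        exact h _ (mem_map.2 ⟨x, mem_union_left _ hx, rfl⟩)
      · rw [mem_edgeSet_graphOfBits_iff s (hD x hx)]
        have := h _ (mem_map.2 ⟨x, mem_union_right _ hx, rfl⟩)
        rw [show pc x = pairCoord x from rfl, hσD x hx] at this
        simp [this]
  rw [hset, bernoulliVec_toOuterMeasure_cylinder, hU, prod_map, prod_union hTD]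
  have h1 : ∏ x ∈ T, bernWeight (edgeProb p) (σ (pc x)) = edgeProb p ^ #T := by
    rw [← prod_const]
    refine prod_congr rfl fun x hx => ?_
    rw [show pc x = pairCoord x from rfl, hσT x hx, bernWeight]
    rfl
  have h2 : ∏ x ∈ D, bernWeight (edgeProb p) (σ (pc x)) = (1 - edgeProb p) ^ #D := by
    rw [← prod_const]
    refine prod_congr rfl fun x hx => ?_
    rw [show pc x = pairCoord x from rfl, hσD x hx, bernWeight]
    rfl
  rw [h1, h2]

/-- The same for the edge FINSET of the sampled graph, with `0 ≤ p ≤ 1` and the answer in real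
numbers: `Pr[T ⊆ E(G) ∧ E(G) ∩ D = ∅] = p^{|T|} (1-p)^{|D|}`. [cite: NenadovSteger2014, proof of Thm. 1 (1-statement), p. 3] -/
theorem erdosRenyi_toOuterMeasure_cylinder_ofReal {n : ℕ} {p : ℝ} (hp0 : 0 ≤ p) (hp1 : p ≤ 1)
    (T D : Finset (Sym2 (Fin n))) (hTD : Disjoint T D) (hT : ∀ x ∈ T, ¬ x.IsDiag)
    (hD : ∀ x ∈ D, ¬ x.IsDiag) :
    (erdosRenyi n p).toOuterMeasure
        {G | (∀ x ∈ T, x ∈ G.edgeSet) ∧ ∀ x ∈ D, x ∉ G.edgeSet} =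
      ENNReal.ofReal (p ^ #T * (1 - p) ^ #D) := by
  rw [erdosRenyi_toOuterMeasure_cylinder p T D hTD hT hD, edgeProb_eq hp1,
    ENNReal.ofReal_mul (by positivity), ENNReal.ofReal_pow hp0, ENNReal.ofReal_pow (by linarith),
    ENNReal.ofReal_sub _ hp0, ENNReal.ofReal_one]

/-! ### Complements -/

/-- **Complement rule** for the outer measure of a PMF: `Pr[s] + Pr[sᶜ] = 1`. [folklore] -/
theorem _root_.PMF.toOuterMeasure_add_compl {α : Type*} (q : PMF α) (s : Set α) :
    q.toOuterMeasure s + q.toOuterMeasure sᶜ = 1 := by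
  rw [PMF.toOuterMeasure_apply, PMF.toOuterMeasure_apply, ← ENNReal.tsum_add, ← q.tsum_coe]
  congr 1
  funext x
  by_cases hx : x ∈ s
  · rw [Set.indicator_of_mem hx, Set.indicator_of_notMem (show x ∉ sᶜ from fun h => h hx),
      add_zero]
  · rw [Set.indicator_of_notMem hx, Set.indicator_of_mem (show x ∈ sᶜ from hx), zero_add]

/-- `Pr[s] = 1 - Pr[sᶜ]` for a PMF. [folklore] -/
theorem _root_.PMF.toOuterMeasure_eq_one_sub_compl {α : Type*} (q : PMF α) (s : Set α) :
    q.toOuterMeasure s = 1 - q.toOuterMeasure sᶜ := by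
  have h := q.toOuterMeasure_add_compl s
  have hle : q.toOuterMeasure sᶜ ≤ 1 := by
    calc q.toOuterMeasure sᶜ ≤ q.toOuterMeasure s + q.toOuterMeasure sᶜ := le_add_self
      _ = 1 := h
  have hfin : q.toOuterMeasure sᶜ ≠ ⊤ := ne_top_of_le_ne_top ENNReal.one_ne_top hle
  rw [← h, ENNReal.add_sub_cancel_right hfin]

end Literature.Probability.RandomGraphs

end
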